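import Summits.BirchSwinnertonDyer.Rank1Residual.Additive.KatoDescentKatoRigidTransport
import Literature.NumberTheory.EllipticCurves.PAdicPowerSeriesZeros
import Mathlib.NumberTheory.Padics.Complex
import Mathlib.FieldTheory.IsAlgClosed.Basic
import Mathlib.NumberTheory.Cyclotomic.PrimitiveRoots
import HarnessLib

set_option autoImplicit false

/-!
# AUG engine, step 12: the CHARACTER POINTS in `ℂ_p` — embeddings `ℚ(ζ_m) → ℂ_p`, preimages of roots of unity under a
# complex frame, and the transport of the level identities `e • r(u − 1) = r′(u − 1)` from `ℚ_p ⊗_ℚ ℂ` to `ℂ_p`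
# (seat `bsd-cm-prr-ty1` g15, cell `bsd-cm`; theorems only: no definition, no named fact, no instance, no `sorry`)

Part 54 of the seat's kernel cut of stub 3 of the Kato–Perrin-Riou skeletons v4 (cruxes stmt-BirchSwinnertonDyer-19945 /
-19223).  The ENDGAME for the display AUG (HOME `bsd-cm-prr-ty1/STUB3-CUT.md` §6 addenda 7–8) reads the identities (★χ) of
E35 `aeval_mul_explicitValues_eq_of_augData`, after the dictionary of E38, as polynomial identities
`e • Q₁(u − 1) = Q₂(u − 1)` in `ℚ_p ⊗_ℚ ℂ` at `u = 1 ⊗ ζ_χ`, `ζ_χ = χ̄(χ_cyc γ)` a `p`-power root of unity in the image of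
the complex frame `ι₁(p^{n+1}) : ℚ(ζ_{p^{n+1}}) → ℂ`.  The separation argument (E40 `eq_of_infinite_agree`) lives in `ℂ_p`.
THIS FILE supplies the passage:
* `nonempty_algHom_cyclotomicField_padicComplex` — an embedding `ℚ(ζ_m) →ₐ[ℚ] ℂ_p` exists (`ℂ_p` is algebraically
  closed, Mathlib `PadicComplex.isAlgClosed`; `IsAlgClosed.lift`); ★ `exists_algHom_tensor_cyclotomicField_padicComplex` —
  hence a `ℚ_p`-algebra map `ψ : ℚ_p ⊗_ℚ ℚ(ζ_m) → ℂ_p`, `ψ(1 ⊗ x) = j x` (`Algebra.TensorProduct.lift`, the `ℚ`-structure of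
  `ℂ_p` taken through `ℚ_p`), under which primitive roots of unity give points `z = ψ(1 ⊗ ζ′) − 1` of the open unit disc with
  `z + 1` primitive of the same order (`isPrimitiveRoot_and_norm_lt_of_eq_ringHom`; tree
  `norm_sub_one_lt_one_of_pow_prime_pow_eq_one`);
* `exists_apply_eq_of_pow_eq_one` — every `m`-th root of unity of `ℂ` is the image under a frame `ι : ℚ(ζ_m) → ℂ` of an
  `m`-th root of unity of `ℚ(ζ_m)` (powers of `ι ζ_m`), primitive roots corresponding to primitive roots
  (`isPrimitiveRoot_of_apply_eq`);
* ★ `smul_aeval_eq_of_map_eq` / ★ `eval₂_eq_of_smul_aeval_eq` / ★ `eval₂_eq_of_smul_aeval_eq_map` — TRANSPORT: an identity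
  `e • Q₁(1 ⊗ ι ζ′ − 1) = Q₂(1 ⊗ ι ζ′ − 1)` in `ℚ_p ⊗_ℚ L` (`ι : K → L` injective; `ℚ_p` flat over `ℚ`, E36
  `map_id_injective`) pulls back to `ℚ_p ⊗_ℚ K` and pushes forward along any `ℚ_p`-algebra map `ψ : ℚ_p ⊗_ℚ K → Ω` as
  `e · Q₁(ψ(1 ⊗ ζ′) − 1) = Q₂(ψ(1 ⊗ ζ′) − 1)`, the polynomials `Qᵢ ∈ ℤ_p[X]` being evaluated through `ℤ_p → ℚ_p → Ω`
  (the shape of E39 `hasSum_coeff_of_sub_coe_mem_span`).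
HONEST LABEL: generic algebra serving the seat's AUG engine; AUG displayed; no stub closed; nothing asserted on 19945 / 19223;
no summit statement is proved; BSD is not proved for any curve.
References: [Kato2004Asterisque] §13.9 (p. 230); [Washington1997] §13.2, Thm. 7.3; [MazurTateTeitelbaum1986Invent] §I.13
(the points `χ(γ) − 1`); Mathlib `NumberTheory/Padics/Complex` (`ℂ_p` algebraically closed), `RingTheory/Flat/Basic`.
-/

noncomputable section

open scoped TensorProduct
open Polynomial

namespace Summit.BirchSwinnertonDyer.Rank1Residual.Additive.PerrinRiouUnit

variable {p : ℕ} [Fact p.Prime]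

/-! ## §1 Embeddings of cyclotomic fields into `ℂ_p` -/

/-- **An embedding `ℚ(ζ_m) →ₐ[ℚ] ℂ_p` exists** (`ℂ_p` is an algebraically closed field of characteristic `0`).
[cite: Washington1997, §13.2] -/
theorem nonempty_algHom_cyclotomicField_padicComplex (m : ℕ) [NeZero m] :
    Nonempty (CyclotomicField m ℚ →ₐ[ℚ] ℂ_[p]) := by
  haveI : Algebra.IsAlgebraic ℚ (CyclotomicField m ℚ) := Algebra.IsAlgebraic.of_finite ℚ _
  exact ⟨IsAlgClosed.lift⟩

/-! ## §2 Roots of unity under a complex frame -/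

section Frame

variable {m : ℕ}

set_option backward.isDefEq.respectTransparency false in
/-- **Every `m`-th root of unity of `ℂ` is the image under a frame `ι : ℚ(ζ_m) → ℂ` of an `m`-th root of unity of
`ℚ(ζ_m)`** (a power of `ζ_m`). [cite: Washington1997, Ch. 2 (basic results)] -/
theorem exists_apply_eq_of_pow_eq_one [NeZero m] (ι : CyclotomicField m ℚ →+* ℂ) {ζ : ℂ} (hζ : ζ ^ m = 1) :
    ∃ ζ' : CyclotomicField m ℚ, ι ζ' = ζ ∧ ζ' ^ m = 1 := by
  have hz := IsCyclotomicExtension.zeta_spec m ℚ (CyclotomicField m ℚ)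
  have hι : IsPrimitiveRoot (ι (IsCyclotomicExtension.zeta m ℚ (CyclotomicField m ℚ))) m :=
    hz.map_of_injective ι.injective
  obtain ⟨i, -, hi⟩ := hι.eq_pow_of_pow_eq_one hζ
  refine ⟨IsCyclotomicExtension.zeta m ℚ (CyclotomicField m ℚ) ^ i, by rw [map_pow, hi], ?_⟩
  rw [← pow_mul, mul_comm, pow_mul, hz.pow_eq_one, one_pow]

/-- A preimage under a frame of a primitive `k`-th root of unity is a primitive `k`-th root of unity. [folklore] -/
theorem isPrimitiveRoot_of_apply_eq (ι : CyclotomicField m ℚ →+* ℂ) {ζ : ℂ} {k : ℕ} (hζ : IsPrimitiveRoot ζ k)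
    {ζ' : CyclotomicField m ℚ} (h : ι ζ' = ζ) : IsPrimitiveRoot ζ' k := by
  rw [← h] at hζ
  exact hζ.of_map_of_injective ι.injective

end Frame

/-! ## §3 Transport of `e • Q₁(u − 1) = Q₂(u − 1)` -/

section Transport

variable {K L : Type*} [Field K] [Algebra ℚ K] [CommRing L] [Algebra ℚ L]

/-- ★ **PULL-BACK along `id ⊗ ι`**: `e • Q₁(1 ⊗ ι ζ − 1) = Q₂(1 ⊗ ι ζ − 1)` in `ℚ_p ⊗_ℚ L` implies the same identity in
`ℚ_p ⊗_ℚ K` at `1 ⊗ ζ` (`ι` injective, `ℚ_p` flat over `ℚ`: E36 `map_id_injective`). [cite: Kato2004Asterisque, §13.9 (p. 230)] -/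
theorem smul_aeval_eq_of_map_eq (ι : K →ₐ[ℚ] L) (hι : Function.Injective ι) {Q₁ Q₂ : ℤ_[p][X]} {e : ℚ_[p]} {ζ : K}
    (h : e • aeval (((1 : ℚ_[p]) ⊗ₜ[ℚ] ι ζ : ℚ_[p] ⊗[ℚ] L) - 1) Q₁ =
      aeval (((1 : ℚ_[p]) ⊗ₜ[ℚ] ι ζ : ℚ_[p] ⊗[ℚ] L) - 1) Q₂) :
    e • aeval (((1 : ℚ_[p]) ⊗ₜ[ℚ] ζ : ℚ_[p] ⊗[ℚ] K) - 1) Q₁ = aeval (((1 : ℚ_[p]) ⊗ₜ[ℚ] ζ : ℚ_[p] ⊗[ℚ] K) - 1) Q₂ := by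
  set Φ := Algebra.TensorProduct.map (AlgHom.id ℚ_[p] ℚ_[p]) ι with hΦ
  apply map_id_injective ι hι
  have h1 : Φ ((1 : ℚ_[p]) ⊗ₜ[ℚ] ζ) = (1 : ℚ_[p]) ⊗ₜ[ℚ] ι ζ := by
    rw [hΦ, Algebra.TensorProduct.map_tmul, AlgHom.id_apply]
  rw [map_smul, algHom_aeval_sub_one, algHom_aeval_sub_one, h1]
  exact h

/-- ★ **PUSH-FORWARD along a `ℚ_p`-algebra map `ψ : ℚ_p ⊗_ℚ K → Ω`**: from `e • Q₁(u − 1) = Q₂(u − 1)` in `ℚ_p ⊗_ℚ K`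
to `e · Q₁(ψ u − 1) = Q₂(ψ u − 1)` in `Ω`, the polynomials `Qᵢ ∈ ℤ_p[X]` being evaluated through `ℤ_p → ℚ_p → Ω` (the
shape of E39 `hasSum_coeff_of_sub_coe_mem_span`). [cite: Kato2004Asterisque, §13.9 (p. 230)] -/
theorem eval₂_eq_of_smul_aeval_eq {Ω : Type*} [CommRing Ω] [Algebra ℚ_[p] Ω] (ψ : ℚ_[p] ⊗[ℚ] K →ₐ[ℚ_[p]] Ω)
    {Q₁ Q₂ : ℤ_[p][X]} {e : ℚ_[p]} {u : ℚ_[p] ⊗[ℚ] K}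
    (h : e • aeval (u - 1) Q₁ = aeval (u - 1) Q₂) :
    algebraMap ℚ_[p] Ω e * Q₁.eval₂ ((algebraMap ℚ_[p] Ω).comp (algebraMap ℤ_[p] ℚ_[p])) (ψ u - 1) =
      Q₂.eval₂ ((algebraMap ℚ_[p] Ω).comp (algebraMap ℤ_[p] ℚ_[p])) (ψ u - 1) := by
  -- `ψ (Q(t)) = Q(ψ t)` through `ℤ_p → ℚ_p → Ω`
  have hev : ∀ (Q : ℤ_[p][X]) (t : ℚ_[p] ⊗[ℚ] K),
      ψ (aeval t Q) = Q.eval₂ ((algebraMap ℚ_[p] Ω).comp (algebraMap ℤ_[p] ℚ_[p])) (ψ t) := fun Q t => by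
    rw [← Polynomial.aeval_map_algebraMap ℚ_[p] t Q, ← Polynomial.aeval_algHom_apply, Polynomial.aeval_def,
      Polynomial.eval₂_map]
  have key := congrArg ψ h
  rw [map_smul, hev, hev, map_sub, map_one, Algebra.smul_def] at key
  exact key

/-- ★ **TRANSPORT, assembled**: from `e • Q₁(1 ⊗ ι ζ − 1) = Q₂(1 ⊗ ι ζ − 1)` in `ℚ_p ⊗_ℚ L` (`ι : K → L` injective) to
`e · Q₁(ψ(1 ⊗ ζ) − 1) = Q₂(ψ(1 ⊗ ζ) − 1)` in any commutative `ℚ_p`-algebra `Ω` along any `ℚ_p`-algebra map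
`ψ : ℚ_p ⊗_ℚ K → Ω`. [cite: Kato2004Asterisque, §13.9 (p. 230)] [cite: Washington1997, §13.2] -/
theorem eval₂_eq_of_smul_aeval_eq_map (ι : K →ₐ[ℚ] L) (hι : Function.Injective ι)
    {Ω : Type*} [CommRing Ω] [Algebra ℚ_[p] Ω] (ψ : ℚ_[p] ⊗[ℚ] K →ₐ[ℚ_[p]] Ω)
    {Q₁ Q₂ : ℤ_[p][X]} {e : ℚ_[p]} {ζ : K}
    (h : e • aeval (((1 : ℚ_[p]) ⊗ₜ[ℚ] ι ζ : ℚ_[p] ⊗[ℚ] L) - 1) Q₁ =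
      aeval (((1 : ℚ_[p]) ⊗ₜ[ℚ] ι ζ : ℚ_[p] ⊗[ℚ] L) - 1) Q₂) :
    algebraMap ℚ_[p] Ω e *
        Q₁.eval₂ ((algebraMap ℚ_[p] Ω).comp (algebraMap ℤ_[p] ℚ_[p])) (ψ ((1 : ℚ_[p]) ⊗ₜ[ℚ] ζ) - 1) =
      Q₂.eval₂ ((algebraMap ℚ_[p] Ω).comp (algebraMap ℤ_[p] ℚ_[p])) (ψ ((1 : ℚ_[p]) ⊗ₜ[ℚ] ζ) - 1) :=
  eval₂_eq_of_smul_aeval_eq ψ (smul_aeval_eq_of_map_eq ι hι h)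

end Transport

/-! ## §4 `ℂ_p` as a target: a `ℚ_p`-algebra map `ℚ_p ⊗_ℚ ℚ(ζ_m) → ℂ_p` through an embedding of `ℚ(ζ_m)` -/

/-- A ring map `ℚ(ζ_m) →+* ℂ` is a `ℚ`-algebra map (characteristic zero). [folklore] -/
theorem coe_toRatAlgHom_ringHom {m : ℕ} [NeZero m] (ι : CyclotomicField m ℚ →+* ℂ) (x : CyclotomicField m ℚ) :
    (ι.toRatAlgHom : CyclotomicField m ℚ →ₐ[ℚ] ℂ) x = ι x := rfl

/-- ★ **A `ℚ_p`-algebra map `ψ : ℚ_p ⊗_ℚ ℚ(ζ_m) → ℂ_p` with `ψ(1 ⊗ x) = j x` for an embedding `j : ℚ(ζ_m) →+* ℂ_p`**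
(`a ⊗ x ↦ a · j x`; the `ℚ`-algebra structure of `ℂ_p` used for the universal property of `⊗_ℚ` is the one through
`ℚ_p`, chosen locally). [cite: Washington1997, §13.2] -/
theorem exists_algHom_tensor_cyclotomicField_padicComplex (m : ℕ) [NeZero m] :
    ∃ (ψ : ℚ_[p] ⊗[ℚ] CyclotomicField m ℚ →ₐ[ℚ_[p]] ℂ_[p]) (j : CyclotomicField m ℚ →+* ℂ_[p]),
      ∀ x : CyclotomicField m ℚ, ψ ((1 : ℚ_[p]) ⊗ₜ[ℚ] x) = j x := by
  obtain ⟨j₀⟩ := nonempty_algHom_cyclotomicField_padicComplex (p := p) m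
  -- forget the `ℚ`-algebra structure of `j₀` (only the ring map is used below)
  obtain ⟨j₁⟩ : Nonempty (CyclotomicField m ℚ →+* ℂ_[p]) := ⟨j₀.toRingHom⟩
  clear j₀
  -- the `ℚ`-algebra structure of `ℂ_p` through `ℚ_p` (local), so that `ℚ → ℚ_p → ℂ_p` is a scalar tower by `rfl`
  letI instQ : Algebra ℚ ℂ_[p] := ((algebraMap ℚ_[p] ℂ_[p]).comp (algebraMap ℚ ℚ_[p])).toAlgebra
  haveI : @IsScalarTower ℚ ℚ_[p] ℂ_[p] _ _ instQ.toSMul :=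
    @IsScalarTower.of_algebraMap_eq ℚ ℚ_[p] ℂ_[p] _ _ _ _ _ instQ (fun _ => rfl)
  let j : CyclotomicField m ℚ →ₐ[ℚ] ℂ_[p] := j₁.toRatAlgHom
  refine ⟨Algebra.TensorProduct.lift (Algebra.ofId ℚ_[p] ℂ_[p]) j (fun x y => Commute.all _ _), j₁,
    fun x => ?_⟩
  rw [Algebra.TensorProduct.lift_tmul, map_one, one_mul]
  rfl

/-- Under such a `ψ`, a primitive `k`-th root of unity `ζ′ ∈ ℚ(ζ_m)` gives the point `z = ψ(1 ⊗ ζ′) − 1` of the open unit disc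
of `ℂ_p` with `z + 1` a primitive `k`-th root of unity. [cite: MazurTateTeitelbaum1986Invent, §I.13] -/
theorem isPrimitiveRoot_and_norm_lt_of_eq_ringHom {m : ℕ} {ψ : ℚ_[p] ⊗[ℚ] CyclotomicField m ℚ →ₐ[ℚ_[p]] ℂ_[p]}
    {j : CyclotomicField m ℚ →+* ℂ_[p]} (hψ : ∀ x : CyclotomicField m ℚ, ψ ((1 : ℚ_[p]) ⊗ₜ[ℚ] x) = j x)
    {ζ' : CyclotomicField m ℚ} {k : ℕ} (hζ' : IsPrimitiveRoot ζ' (p ^ k)) :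
    IsPrimitiveRoot (ψ ((1 : ℚ_[p]) ⊗ₜ[ℚ] ζ') - 1 + 1) (p ^ k) ∧ ‖ψ ((1 : ℚ_[p]) ⊗ₜ[ℚ] ζ') - 1‖ < 1 := by
  rw [sub_add_cancel, hψ]
  have h1 : IsPrimitiveRoot (j ζ') (p ^ k) := hζ'.map_of_injective j.injective
  exact ⟨h1, Literature.NumberTheory.EllipticCurves.norm_sub_one_lt_one_of_pow_prime_pow_eq_one h1.pow_eq_one⟩

end Summit.BirchSwinnertonDyer.Rank1Residual.Additive.PerrinRiouUnit

end
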